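import Literature.NumberTheory.ComplexMultiplication.TateHalfTransferCM
import Literature.NumberTheory.NumberFields.PrincipalIdelesFiniteClosure
import Literature.NumberTheory.AdelicBaseChange.AdeleNormTower
import Literature.NumberTheory.Automorphic.ClassFieldCharacter
import HarnessLib

/-!
# The Taniyama element `f_Φ(σ) ∈ 𝔸^×_{E,f}/E^×` of a CM type: Milne's Proposition 4.6 (Tate) and Proposition 4.8 (a), (c)
# (Milne, *The fundamental theorem of complex multiplication*, arXiv:0705.3446, §4.2)

Topic `NumberTheory/ComplexMultiplication`; namespace `Literature.NumberTheory.ComplexMultiplication`.  Lane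
`lit-hodgefound` (Track 2, Layer A3 skeleton seat `skel-3`, row A3-G45 FILE 4 of 4; FILE 1 `…/TateHalfTransfer` (group
theory), FILE 2 `…/NumberFields/IdelicArtinMapConjugation` (`art_E(ιf) = ι art_E(f) ι⁻¹`), FILE 3 `…/TateHalfTransferCM`
(`F_Φ : Γ_ℚ → Γ_E^ab`, `F_Φ(σ)·ιF_Φ(σ)ι⁻¹ = Ver_{E/ℚ}(σ) = [con(1,χ_cyc σ), E]⁻¹`)).  Definitions with bodies
(`finiteClassArtinMap`, `finiteIdeleConjGal`, `finiteClassConjGal`, `cyclotomicFiniteIdeleIn`, `taniyamaElement`) and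
theorems, all proved; no named fact, no instance (D-0026, net debt 0).

## The print, verbatim

J. S. Milne, *The fundamental theorem of complex multiplication*, arXiv:0705.3446 [Milne2007FundamentalCM], §4.2 (held
`paper:arxiv-0705.3446` p0019 L154–p0020 L31):

> «PROPOSITION 4.6. For any `σ ∈ Aut(ℂ)`, there is a unique `f_Φ(σ) ∈ 𝔸^×_{f,E}/E^×` such that (a) `art_E(f_Φ(σ)) = F_Φ(σ)`;
> (b) `f_Φ(σ)·ιf_Φ(σ) = χ(σ)E^×`, `χ = χ_cyc`.  PROOF. Since `art_E` is surjective, there is an `f ∈ 𝔸^×_{f,E}/E^×` such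
> that `art_E(f) = F_Φ(σ)`. We have `art_E(f·ιf) = art_E(f)·art_E(ιf) = art_E(f)·ι art_E(f)ι⁻¹ = F_Φ(σ)·F_{ιΦ}(σ) =
> Ver_{E/ℚ}(σ)`, where `Ver_{E/ℚ} : Gal(ℚ^al/ℚ)^ab → Gal(ℚ^al/E)^ab` is the transfer (Verlagerung) map. As
> `Ver_{E/ℚ} = art_E ∘ χ`, it follows that `f·ιf = χ(σ)E^×` modulo `Ker(art_E)`. Lemma 3.6 shows that `1 + ι` acts
> bijectively on `Ker(art_E)`, and so there is a unique `a ∈ Ker(art_E)` such that `a·ιa = (f·ιf/χ(σ))E^×`; we must take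
> `f_Φ(σ) = f/a`.  REMARK 4.7. The above definition of `f_Φ(σ)` is due to Tate. […]  PROPOSITION 4.8. The maps
> `f_Φ : Aut(ℂ) → 𝔸^×_{f,E}/E^×` have the following properties: (a) `f_Φ(στ) = f_{τΦ}(σ)·f_Φ(τ)`;
> (b) `f_{Φ(τ⁻¹|E)}(σ) = τf_Φ(σ)` if `τE = E`; (c) `f_Φ(ι) = 1`.  PROOF. Let `f = f_{τΦ}(σ)·f_Φ(τ)`. Then
> `art_E(f) = F_{τΦ}(σ)·F_Φ(τ) = […] = F_Φ(στ)` and `f·ιf = χ(σ)χ(τ)E^× = χ(στ)E^×`. Thus `f` satisfies the conditions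
> that determine `f_Φ(στ)`. This proves (a), and (b) and (c) can be proved similarly.»

C. Blake, *A plectic Taniyama group*, arXiv:1606.03320 [Blake2016PlecticTaniyama] §1 (held p0003 L34): «There is a natural
way to lift `F_Φ` through the Artin reciprocity map to a map `f_Φ : Γ_ℚ → 𝔸^×_{K,f}/K^×` called the associated Taniyama
element. This is determined by requiring that for any `g ∈ Γ_ℚ` we have `f_Φ(g)^{1+c} = χ(g)K^×`.»

## Setting (the tree's vocabulary) and sign convention

`K : Type` a CM number field; `(𝔸_{K,f})ˣ = (FiniteAdeleRing (𝓞 K) K)ˣ`, `K^× ↪ (𝔸_{K,f})ˣ` = `FiniteAdeleRing.unitEmbedding`,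
`𝔸^×_{K,f}/K^×` = the quotient `(𝔸_{K,f})ˣ ⧸ K^×`; `(1, y) ∈ 𝕀_K` = `Units.map inr y`; **`[·, K] = ideleArtinMap K = rec_K`**
while Milne's `art_K = rec_K⁻¹` («`art_k` is its reciprocal», §4 p0018), so Milne's (a) `art_E(f) = F_Φ(σ)` reads
**`[(1, f), E] = F_Φ(σ)⁻¹`** here; `ι_E` on `(𝔸_{K,f})ˣ` is the PLACE-BY-PLACE action of `IsCMField.complexConj K ∈ Gal(K/K⁺)`
(`…Automorphic/GaloisActionAdeleRing`, as in `…/PrincipalIdelesFiniteClosure` §5); `χ(σ) ∈ Ẑ^× ⊂ 𝔸^×_{K,f}` is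
`cyclotomicFiniteIdeleIn K σ = (con_{K/ℚ} (1, χ_cyc σ))_𝐡` (row A3-G40's `cyclotomicIdele`, the packet's conorm).

## What is formalised

* §1 `finiteClassArtinMap K : (𝔸_{K,f})ˣ/K^× →* Γ_K^ab` (`y ↦ [(1, y), K]`; `K` totally complex), onto, with kernel the image
  of the closure `Ē` of `K^×` (A3-G39 FILE 2).
* §2 `finiteIdeleConjGal K` = `ι_K` on `(𝔸_{K,f})ˣ` and `finiteClassConjGal K` on `(𝔸_{K,f})ˣ/K^×`; `ι_K • (1, y) = (1, ι_K y)`;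
  **`θ_c^ab [(1, y), K] = [(1, ι_K y), K]`** (FILE 3's `absGaloisConjAb_complexConj_ideleArtinMap`) — «`art_E(ιf) = ι art_E(f)ι⁻¹`».
* §3 **PROPOSITION 4.6 in the tree's vocabulary** (`existsUnique_finiteClassArtinMap_eq_and_mul_conj_eq`): for `F ∈ Γ_K^ab`
  and `u ∈ (𝔸_{K,f})ˣ` with `F · θ_c^ab(F) = [(1, u), K]⁻¹` there is a UNIQUE class `φ ∈ (𝔸_{K,f})ˣ/K^×` with
  `[(1, φ), K] = F⁻¹` and `φ · ι_K φ = u·K^×`.  Existence: `art` onto; `t = f·ιf·u⁻¹ ∈ ker = Ē`; `t = a·w²` with `a ∈ K^×`,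
  `w ∈ Ē` (Ē/K^× divisible, A3-G39 `exists_mem_range_mul_pow_eq`) and `ιw ≡ w` (Lemma 3.6 = 9.6, `inv_mul_conj_mem_range…`);
  take `f/w`.  Uniqueness: `v ∈ Ē` with `v·ιv ∈ K^×` has `v² ∈ K^×`, so `v ∈ K^×` (Ē/K^× torsion-free,
  `mem_range_of_pow_mem_range`) — «`1 + ι` acts bijectively on `Ker(art_E)`».
* §4 `cyclotomicFiniteIdeleIn K : Γ_ℚ →* (𝔸_{K,f})ˣ`, `[(1, χ(σ)), K] = [con(1, χ_cyc σ), K]`, `ι_K χ(σ) = χ(σ)`, and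
  `χ(c) = -1 ∈ K^×` for a complex conjugation `c`.
* §5 **`taniyamaElement K hc Ψ σ ∈ (𝔸_{K,f})ˣ/K^×`** — Tate's `f_Φ(σ)` for a CM type `Ψ ⊆ Γ_ℚ ⧸ res(Γ_K)` (FILE 3) and
  `σ ∈ Γ_ℚ`: the unique class with **(a) `[(1, f), K] = F_Ψ(σ)⁻¹`** and **(b) `f · ι_K f = χ(σ)·K^×`**
  (`finiteClassArtinMap_taniyamaElement`, `taniyamaElement_mul_conj`, uniqueness `eq_taniyamaElement`), from §3 and FILE 3's
  `F_Ψ(σ)·θ_c^ab F_Ψ(σ) = [con(1,χ_cyc σ), K]⁻¹`; **PROP. 4.8 (a) `f_Ψ(στ) = f_{τΨ}(σ)·f_Ψ(τ)`** (`taniyamaElement_mul`) and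
  **(c) `f_Ψ(c) = 1`** (`taniyamaElement_self`), by uniqueness exactly as printed.

NOT HERE: Prop. 4.8 (b); Prop. 4.9 (`N_Φ(a) ∈ f_Φ(σ)` for `σ ∈ Γ_{E*}` — the junction with A3-G39's
`reflexNormFiniteClassOfGalois`; a later row); Theorems 4.1/4.2 (abelian varieties; Layer B); Milne's `Aut(ℂ)`-parametrisation
(`σ ∈ Γ_ℚ` here, cf. FILE 3).

## References

* J. S. Milne, *The fundamental theorem of complex multiplication*, arXiv:0705.3446 (2007), §4.2 Prop. 4.6, Rem. 4.7,
  Prop. 4.8; §3 Lemma 3.6. [Milne2007FundamentalCM]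
* C. Blake, *A plectic Taniyama group*, arXiv:1606.03320 (2016), §1. [Blake2016PlecticTaniyama]
* J. S. Milne, *Complex Multiplication* (course notes), Ch. II §9, Lemma 9.6. [MilneCM2006]

## Provenance

Lane `lit-hodgefound`, seat `literature-prover-lit-hodgefound-skel-3-g29-0` (row A3-G45, FILE 4 of 4).
-/

noncomputable section

open scoped Pointwise
open Field NumberField IsDedekindDomain

namespace Literature.NumberTheory.ComplexMultiplication

open Literature.NumberTheory.GaloisRepresentations Literature.NumberTheory.NumberFields
open Literature.NumberTheory.AdelicBaseChange
open HalfTransfer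

/-! ### §1. The Artin map on `𝔸^×_{K,f}/K^×` -/

section FiniteClass

variable (K : Type) [Field K] [NumberField K]

variable [IsTotallyComplex K]

/-- `K^× ≤ ker (y ↦ [(1, y), K])` for `K` totally complex (the kernel is the closure `Ē` of `K^×`, A3-G39
`FiniteIdeleClosure.ker_ideleArtinMap_comp_units_map_inr_eq`). [cite: Milne2007FundamentalCM, §4 («art_k for the map 𝔸^×_{f,k} → Gal(k^ab/k)»)] -/
theorem range_unitEmbedding_le_ker_ideleArtinMap_comp_inr :
    (FiniteAdeleRing.unitEmbedding (𝓞 K) K).range ≤ ((ideleArtinMap K).comp (Units.map (N := AdeleRing (𝓞 K) K)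
          (MonoidHom.inr (InfiniteAdeleRing K) (FiniteAdeleRing (𝓞 K) K)))).ker := by
  rw [FiniteIdeleClosure.ker_ideleArtinMap_comp_units_map_inr_eq K]
  exact Subgroup.le_topologicalClosure _

/-- **`art` on `𝔸^×_{K,f}/K^×`: `y·K^× ↦ [(1, y), K]`** (`K` totally complex, so `[·, K]` factors through the finite idèles and
kills `K^×`) — Milne's «we also write `art_k` for the map `𝔸^×_{f,k} → Gal(k^ab/k)`», up to the tree's sign `[·, K] = art⁻¹`.
[cite: Milne2007FundamentalCM, §4 (notations), §4.2 Prop. 4.6 (a)] -/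
def finiteClassArtinMap :
    (FiniteAdeleRing (𝓞 K) K)ˣ ⧸ (FiniteAdeleRing.unitEmbedding (𝓞 K) K).range →* absoluteGaloisGroupAbelianization K :=
  QuotientGroup.lift _ ((ideleArtinMap K).comp (Units.map (N := AdeleRing (𝓞 K) K)
        (MonoidHom.inr (InfiniteAdeleRing K) (FiniteAdeleRing (𝓞 K) K)))) (range_unitEmbedding_le_ker_ideleArtinMap_comp_inr K)

/-- Unfolding: `finiteClassArtinMap K (y·K^×) = [(1, y), K]`. [cite: Milne2007FundamentalCM, §4.2 Prop. 4.6 (a)] -/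
@[simp] theorem finiteClassArtinMap_mk (y : (FiniteAdeleRing (𝓞 K) K)ˣ) :
    finiteClassArtinMap K (QuotientGroup.mk y) = ideleArtinMap K ((Units.map (N := AdeleRing (𝓞 K) K)
          (MonoidHom.inr (InfiniteAdeleRing K) (FiniteAdeleRing (𝓞 K) K))) y) := rfl

/-- **«Since `art_E` is surjective»**: `finiteClassArtinMap K` is onto `Γ_K^ab`. [cite: Milne2007FundamentalCM, §4.2 Prop. 4.6 (proof)] -/
theorem finiteClassArtinMap_surjective : Function.Surjective (finiteClassArtinMap K) := fun γ => by
  obtain ⟨y, hy⟩ := FiniteIdeleClosure.ideleArtinMap_comp_units_map_inr_surjective K γ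
  exact ⟨QuotientGroup.mk y, hy⟩

/-- **«`Ker(art_E)`»**: `finiteClassArtinMap K (y·K^×) = 1 ↔ y ∈ Ē`, the closure of `K^×` in `(𝔸_{K,f})ˣ` (A3-G39 FILE 2, Milne CM
Lemma 9.6 / 2007 Lemma 3.6: «The kernel of `art_E` is `Ē^×/E^×`»). [cite: Milne2007FundamentalCM, §3 Lemma 3.6, §4.2 Prop. 4.6 (proof)] -/
theorem finiteClassArtinMap_mk_eq_one_iff (y : (FiniteAdeleRing (𝓞 K) K)ˣ) :
    finiteClassArtinMap K (QuotientGroup.mk y) = 1 ↔ y ∈ (FiniteAdeleRing.unitEmbedding (𝓞 K) K).range.topologicalClosure := by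
  rw [finiteClassArtinMap_mk, ← FiniteIdeleClosure.ker_ideleArtinMap_comp_units_map_inr_eq K, MonoidHom.mem_ker,
    MonoidHom.comp_apply]

end FiniteClass

/-! ### §2. `ι_K` on finite idèles and on `𝔸^×_{K,f}/K^×`; `θ_c^ab [(1,y), K] = [(1, ι_K y), K]` -/

section Conj

variable (K : Type) [Field K] [NumberField K] [IsCMField K]

/-- **`ι_K` on the finite idèles `(𝔸_{K,f})ˣ`** of a CM field: the place-by-place action of `IsCMField.complexConj K ∈ Gal(K/K⁺)`
(`…Automorphic/GaloisActionAdeleRing`: `(ιy)_{ιw} = ι_w(y_w)`), as in `…/PrincipalIdelesFiniteClosure` §5.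
[cite: Milne2007FundamentalCM, §4.2 Prop. 4.6 (b) («ι f_Φ(σ)»)] -/
def finiteIdeleConjGal : (FiniteAdeleRing (𝓞 K) K)ˣ →* (FiniteAdeleRing (𝓞 K) K)ˣ :=
  Units.map (MulSemiringAction.toRingHom (K ≃ₐ[maximalRealSubfield K] K) (FiniteAdeleRing (𝓞 K) K)
    (IsCMField.complexConj K) : FiniteAdeleRing (𝓞 K) K →* FiniteAdeleRing (𝓞 K) K)

/-- Unfolding: `(ι_K y : 𝔸_{K,f}) = ι_K • (y : 𝔸_{K,f})`. [cite: Milne2007FundamentalCM, §4.2 Prop. 4.6 (b)] -/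
@[simp] theorem coe_finiteIdeleConjGal (y : (FiniteAdeleRing (𝓞 K) K)ˣ) :
    ((finiteIdeleConjGal K y : (FiniteAdeleRing (𝓞 K) K)ˣ) : FiniteAdeleRing (𝓞 K) K) =
      IsCMField.complexConj K • (y : FiniteAdeleRing (𝓞 K) K) := rfl

/-- `ι_K ∘ ι_K = 1` in `Gal(K/K⁺)`. [cite: Milne2007FundamentalCM, §4.1 («involution ι_E»)] -/
private theorem complexConj_mul_complexConj : IsCMField.complexConj K * IsCMField.complexConj K = 1 :=
  AlgEquiv.ext fun x => IsCMField.complexConj_apply_apply K x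

/-- `ι_K` is an involution on `(𝔸_{K,f})ˣ`. [cite: Milne2007FundamentalCM, §4.2 Prop. 4.6] -/
theorem finiteIdeleConjGal_finiteIdeleConjGal (y : (FiniteAdeleRing (𝓞 K) K)ˣ) :
    finiteIdeleConjGal K (finiteIdeleConjGal K y) = y :=
  Units.ext (by rw [coe_finiteIdeleConjGal, coe_finiteIdeleConjGal, smul_smul, complexConj_mul_complexConj, one_smul])

/-- **`ι_K (a) = (ā)` on principal finite idèles.** [cite: Milne2007FundamentalCM, §4.2 Prop. 4.6 («E^×»)] -/
theorem finiteIdeleConjGal_unitEmbedding (a : Kˣ) :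
    finiteIdeleConjGal K (FiniteAdeleRing.unitEmbedding (𝓞 K) K a) =
      FiniteAdeleRing.unitEmbedding (𝓞 K) K (Units.map (IsCMField.complexConj K : K →* K) a) :=
  Units.ext (by
    rw [coe_finiteIdeleConjGal, FiniteAdeleRing.unitEmbedding_apply, FiniteAdeleRing.unitEmbedding_apply,
      Literature.NumberTheory.Automorphic.FiniteAdeleRing.smul_algebraMap]
    rfl)

/-- `ι_K` maps `K^×` onto itself. [cite: Milne2007FundamentalCM, §4.2 Prop. 4.6] -/
theorem range_unitEmbedding_le_comap_finiteIdeleConjGal :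
    (FiniteAdeleRing.unitEmbedding (𝓞 K) K).range ≤ ((FiniteAdeleRing.unitEmbedding (𝓞 K) K).range).comap (finiteIdeleConjGal K) := by
  rintro _ ⟨a, rfl⟩
  rw [Subgroup.mem_comap, finiteIdeleConjGal_unitEmbedding]
  exact ⟨_, rfl⟩

/-- **`ι_K` on `𝔸^×_{K,f}/K^×`.** [cite: Milne2007FundamentalCM, §4.2 Prop. 4.6 (b)] -/
def finiteClassConjGal : (FiniteAdeleRing (𝓞 K) K)ˣ ⧸ (FiniteAdeleRing.unitEmbedding (𝓞 K) K).range →*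
    (FiniteAdeleRing (𝓞 K) K)ˣ ⧸ (FiniteAdeleRing.unitEmbedding (𝓞 K) K).range :=
  QuotientGroup.map _ _ (finiteIdeleConjGal K) (range_unitEmbedding_le_comap_finiteIdeleConjGal K)

/-- Unfolding: `ι_K (y·K^×) = (ι_K y)·K^×`. [cite: Milne2007FundamentalCM, §4.2 Prop. 4.6 (b)] -/
@[simp] theorem finiteClassConjGal_mk (y : (FiniteAdeleRing (𝓞 K) K)ˣ) :
    finiteClassConjGal K (QuotientGroup.mk y) = QuotientGroup.mk (finiteIdeleConjGal K y) := rfl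

/-- `ι_K` is an involution on `𝔸^×_{K,f}/K^×`. [cite: Milne2007FundamentalCM, §4.2 Prop. 4.6] -/
theorem finiteClassConjGal_finiteClassConjGal (φ : (FiniteAdeleRing (𝓞 K) K)ˣ ⧸ (FiniteAdeleRing.unitEmbedding (𝓞 K) K).range) :
    finiteClassConjGal K (finiteClassConjGal K φ) = φ := by
  induction φ using QuotientGroup.induction_on with
  | H y => rw [finiteClassConjGal_mk, finiteClassConjGal_mk, finiteIdeleConjGal_finiteIdeleConjGal]

/-- **`ι_K • (1, y) = (1, ι_K y)` in `𝕀_K`** (the Galois action is componentwise on `K_∞ × 𝔸_{K,f}` and fixes `1`).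
[cite: Milne2007FundamentalCM, §4.2 Prop. 4.6 (proof)] -/
theorem complexConj_smul_units_map_inr (y : (FiniteAdeleRing (𝓞 K) K)ˣ) :
    IsCMField.complexConj K • ((Units.map (N := AdeleRing (𝓞 K) K)
          (MonoidHom.inr (InfiniteAdeleRing K) (FiniteAdeleRing (𝓞 K) K))) y) = (Units.map (N := AdeleRing (𝓞 K) K)
          (MonoidHom.inr (InfiniteAdeleRing K) (FiniteAdeleRing (𝓞 K) K))) (finiteIdeleConjGal K y) := by
  apply Units.ext
  rw [Literature.NumberTheory.Automorphic.AdeleRing.coe_smul_units]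
  change IsCMField.complexConj K • ((1, (y : FiniteAdeleRing (𝓞 K) K)) : AdeleRing (𝓞 K) K) =
    ((1, ((finiteIdeleConjGal K y : (FiniteAdeleRing (𝓞 K) K)ˣ) : FiniteAdeleRing (𝓞 K) K)) : AdeleRing (𝓞 K) K)
  rw [Literature.NumberTheory.Automorphic.AdeleRing.smul_mk, smul_one, coe_finiteIdeleConjGal]

variable {K} {φ : ℚ →+* ℝ} {c : absoluteGaloisGroup ℚ} (hc : IsComplexConjugation φ c)
include hc

/-- **«`art_E(ιf) = ι art_E(f) ι⁻¹`»: `θ_c^ab [(1, y), K] = [(1, ι_K y), K]`** for every finite idèle `y` (FILE 3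
`absGaloisConjAb_complexConj_ideleArtinMap` at `x = (1, y)`). [cite: Milne2007FundamentalCM, §4.2 Prop. 4.6 (proof)] -/
theorem absGaloisConjAb_ideleArtinMap_inr (y : (FiniteAdeleRing (𝓞 K) K)ˣ) :
    absGaloisConjAb (smul_absEmbedding_eq_complexConjRat hc) (ideleArtinMap K ((Units.map (N := AdeleRing (𝓞 K) K)
          (MonoidHom.inr (InfiniteAdeleRing K) (FiniteAdeleRing (𝓞 K) K))) y)) =
      ideleArtinMap K ((Units.map (N := AdeleRing (𝓞 K) K)
            (MonoidHom.inr (InfiniteAdeleRing K) (FiniteAdeleRing (𝓞 K) K))) (finiteIdeleConjGal K y)) := by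
  rw [absGaloisConjAb_complexConj_ideleArtinMap hc, complexConj_smul_units_map_inr]

/-- The same on classes: `θ_c^ab (finiteClassArtinMap K φ) = finiteClassArtinMap K (ι_K φ)`.
[cite: Milne2007FundamentalCM, §4.2 Prop. 4.6 (proof)] -/
theorem absGaloisConjAb_finiteClassArtinMap (φ : (FiniteAdeleRing (𝓞 K) K)ˣ ⧸ (FiniteAdeleRing.unitEmbedding (𝓞 K) K).range) :
    absGaloisConjAb (smul_absEmbedding_eq_complexConjRat hc) (finiteClassArtinMap K φ) =
      finiteClassArtinMap K (finiteClassConjGal K φ) := by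
  induction φ using QuotientGroup.induction_on with
  | H y => rw [finiteClassArtinMap_mk, finiteClassConjGal_mk, finiteClassArtinMap_mk, absGaloisConjAb_ideleArtinMap_inr hc]

end Conj

/-! ### §3. Proposition 4.6: existence and uniqueness of the lift -/

section Prop46

variable (K : Type) [Field K] [NumberField K] [IsCMField K] {φ : ℚ →+* ℝ} {c : absoluteGaloisGroup ℚ}
  (hc : IsComplexConjugation φ c)

/-- **LEMMA 3.6 used as «`1 + ι` is injective on `Ker(art_E)`»**: if `v ∈ Ē` (the closure of `K^×`) and `v · ι_K v ∈ K^×` then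
`v ∈ K^×` — `ι_K v ≡ v (mod K^×)` (`FiniteIdeleClosure.inv_mul_conj_mem_range_of_mem_topologicalClosure`), so `v² ∈ K^×`, and
`Ē/K^×` is torsion-free (`FiniteIdeleClosure.mem_range_of_pow_mem_range`).
[cite: Milne2007FundamentalCM, §3 Lemma 3.6, §4.2 Prop. 4.6 (proof: «1 + ι acts bijectively on Ker(art_E)»)] -/
theorem mem_range_of_mem_topologicalClosure_of_mul_conj_mem_range {v : (FiniteAdeleRing (𝓞 K) K)ˣ}
    (hv : v ∈ (FiniteAdeleRing.unitEmbedding (𝓞 K) K).range.topologicalClosure)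
    (hvv : v * finiteIdeleConjGal K v ∈ (FiniteAdeleRing.unitEmbedding (𝓞 K) K).range) :
    v ∈ (FiniteAdeleRing.unitEmbedding (𝓞 K) K).range := by
  have h96 : v⁻¹ * finiteIdeleConjGal K v ∈ (FiniteAdeleRing.unitEmbedding (𝓞 K) K).range :=
    FiniteIdeleClosure.inv_mul_conj_mem_range_of_mem_topologicalClosure K hv
  have hsq : v ^ 2 ∈ (FiniteAdeleRing.unitEmbedding (𝓞 K) K).range := by
    have := mul_mem hvv (inv_mem h96)
    rwa [mul_inv_rev, inv_inv, mul_assoc, mul_inv_cancel_left, ← pow_two] at this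
  exact FiniteIdeleClosure.mem_range_of_pow_mem_range K hv two_ne_zero hsq

/-- **PROPOSITION 4.6 — UNIQUENESS.**  Two finite idèles `f, f'` with `[(1,f), K] = [(1,f'), K]` and `f·ιf ≡ f'·ιf' (mod K^×)`
are congruent mod `K^×`: `v = f⁻¹f' ∈ Ker = Ē` and `v·ιv ∈ K^×`, so `v ∈ K^×` by Lemma 3.6
(`mem_range_of_mem_topologicalClosure_of_mul_conj_mem_range`). [cite: Milne2007FundamentalCM, §4.2 Prop. 4.6 (proof: «unique a ∈ Ker(art_E)»)] -/
theorem inv_mul_mem_range_of_ideleArtinMap_inr_eq {f f' : (FiniteAdeleRing (𝓞 K) K)ˣ}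
    (hart : ideleArtinMap K ((Units.map (N := AdeleRing (𝓞 K) K)
          (MonoidHom.inr (InfiniteAdeleRing K) (FiniteAdeleRing (𝓞 K) K))) f) = ideleArtinMap K ((Units.map (N := AdeleRing (𝓞 K) K)
          (MonoidHom.inr (InfiniteAdeleRing K) (FiniteAdeleRing (𝓞 K) K))) f'))
    (hconj : (f * finiteIdeleConjGal K f)⁻¹ * (f' * finiteIdeleConjGal K f') ∈ (FiniteAdeleRing.unitEmbedding (𝓞 K) K).range) :
    f⁻¹ * f' ∈ (FiniteAdeleRing.unitEmbedding (𝓞 K) K).range := by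
  have hv : f⁻¹ * f' ∈ (FiniteAdeleRing.unitEmbedding (𝓞 K) K).range.topologicalClosure := by
    rw [← FiniteIdeleClosure.ker_ideleArtinMap_comp_units_map_inr_eq K, MonoidHom.mem_ker, MonoidHom.comp_apply, map_mul,
      map_inv, map_mul, map_inv, hart, inv_mul_cancel]
  refine mem_range_of_mem_topologicalClosure_of_mul_conj_mem_range K hv ?_
  have : f⁻¹ * f' * finiteIdeleConjGal K (f⁻¹ * f') = (f * finiteIdeleConjGal K f)⁻¹ * (f' * finiteIdeleConjGal K f') := by
    rw [map_mul, map_inv, mul_mul_mul_comm, mul_inv]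
  rw [this]
  exact hconj

include hc

/-- **PROPOSITION 4.6 — EXISTENCE.**  For `F ∈ Γ_K^ab` and `u ∈ (𝔸_{K,f})ˣ` with `F · θ_c^ab(F) = [(1, u), K]⁻¹` there is a finite
idèle `f` with `[(1, f), K] = F⁻¹` and `f · ι_K f ≡ u (mod K^×)`.  PROOF as printed: `art` is onto, so pick `f₁` with
`[(1,f₁), K] = F⁻¹`; `t = f₁·ιf₁·u⁻¹` has `[(1,t), K] = 1`, so `t ∈ Ē`, `t = a·w²` with `a ∈ K^×`, `w ∈ Ē` (`Ē/K^×` divisible) and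
`ιw ∈ w·K^×` (Lemma 3.6); then `f = f₁/w` works. [cite: Milne2007FundamentalCM, §4.2 Prop. 4.6 (proof)] [cite: MilneCM2006, Ch. II §9, Lemma 9.6] -/
theorem exists_ideleArtinMap_inr_eq_and_inv_mul_mem_range (F : absoluteGaloisGroupAbelianization K)
    (u : (FiniteAdeleRing (𝓞 K) K)ˣ)
    (hF : F * absGaloisConjAb (smul_absEmbedding_eq_complexConjRat hc) F = (ideleArtinMap K ((Units.map (N := AdeleRing (𝓞 K) K)
          (MonoidHom.inr (InfiniteAdeleRing K) (FiniteAdeleRing (𝓞 K) K))) u))⁻¹) :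
    ∃ f : (FiniteAdeleRing (𝓞 K) K)ˣ, ideleArtinMap K ((Units.map (N := AdeleRing (𝓞 K) K)
          (MonoidHom.inr (InfiniteAdeleRing K) (FiniteAdeleRing (𝓞 K) K))) f) = F⁻¹ ∧
      (f * finiteIdeleConjGal K f)⁻¹ * u ∈ (FiniteAdeleRing.unitEmbedding (𝓞 K) K).range := by
  -- «Since art_E is surjective, there is an f such that art_E(f) = F_Φ(σ)»
  obtain ⟨f₁, hf₁⟩ := FiniteIdeleClosure.ideleArtinMap_comp_units_map_inr_surjective K F⁻¹
  rw [MonoidHom.comp_apply] at hf₁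
  -- `t = f₁ · ι f₁ · u⁻¹ ∈ Ker = Ē`
  set t := f₁ * finiteIdeleConjGal K f₁ * u⁻¹ with ht
  have htker : ideleArtinMap K ((Units.map (N := AdeleRing (𝓞 K) K)
        (MonoidHom.inr (InfiniteAdeleRing K) (FiniteAdeleRing (𝓞 K) K))) t) = 1 := by
    rw [ht, map_mul, map_mul, map_mul, map_mul, map_inv, map_inv, ← absGaloisConjAb_ideleArtinMap_inr hc, hf₁, map_inv,
      ← mul_inv, hF, inv_inv, mul_inv_cancel]
  have htE : t ∈ (FiniteAdeleRing.unitEmbedding (𝓞 K) K).range.topologicalClosure := by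
    rw [← FiniteIdeleClosure.ker_ideleArtinMap_comp_units_map_inr_eq K, MonoidHom.mem_ker, MonoidHom.comp_apply]
    exact htker
  -- `t = a · w²`, `a ∈ K^×`, `w ∈ Ē`, and `w⁻¹ · ι w ∈ K^×` (Lemma 3.6)
  obtain ⟨a, ha, w, hw, htw⟩ := FiniteIdeleClosure.exists_mem_range_mul_pow_eq K htE two_ne_zero
  have hwι : w⁻¹ * finiteIdeleConjGal K w ∈ (FiniteAdeleRing.unitEmbedding (𝓞 K) K).range :=
    FiniteIdeleClosure.inv_mul_conj_mem_range_of_mem_topologicalClosure K hw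
  have hwker : ideleArtinMap K ((Units.map (N := AdeleRing (𝓞 K) K)
        (MonoidHom.inr (InfiniteAdeleRing K) (FiniteAdeleRing (𝓞 K) K))) w) = 1 := by
    have hw' := hw
    rw [← FiniteIdeleClosure.ker_ideleArtinMap_comp_units_map_inr_eq K, MonoidHom.mem_ker, MonoidHom.comp_apply] at hw'
    exact hw'
  refine ⟨f₁ * w⁻¹, ?_, ?_⟩
  · rw [map_mul, map_mul, map_inv, map_inv, hwker, inv_one, mul_one, hf₁]
  · -- `f ιf = (f₁ ιf₁) · w⁻¹ (ιw)⁻¹ = t u · w⁻¹ (ιw)⁻¹ = u · a · (w⁻¹ ι w)⁻¹`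
    have key : f₁ * w⁻¹ * finiteIdeleConjGal K (f₁ * w⁻¹) = u * (a * (w⁻¹ * finiteIdeleConjGal K w)⁻¹) := by
      have h1 : f₁ * finiteIdeleConjGal K f₁ = t * u := by rw [ht, inv_mul_cancel_right]
      rw [map_mul, map_inv, mul_mul_mul_comm, h1, htw, pow_two, mul_inv_rev, inv_inv]
      simp only [mul_assoc]
      rw [mul_left_comm w u, mul_inv_cancel_left]
      ac_rfl
    rw [key, mul_inv_rev, inv_mul_cancel_right]
    exact inv_mem (mul_mem ha (inv_mem hwι))

/-- **PROPOSITION 4.6 (Tate; Milne 2007) IN THE TREE'S VOCABULARY.**  Let `K` be a CM field, `c ∈ Γ_ℚ` a complex conjugation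
(`θ_c^ab` = conjugation by `c` on `Γ_K^ab = Gal(K^ab/K)`, FILES 2/3), `F ∈ Γ_K^ab` and `u ∈ (𝔸_{K,f})ˣ` with
**`F · θ_c^ab(F) = [(1, u), K]⁻¹`** (for `F = F_Φ(σ)`, `u = χ_cyc(σ)` this is «`F_Φ(σ)·F_{ιΦ}(σ) = Ver_{E/ℚ}(σ) = art_E(χ(σ))`»,
FILE 3).  Then there is a UNIQUE `φ ∈ 𝔸^×_{K,f}/K^×` with **`[(1, φ), K] = F⁻¹`** (Milne's (a) `art_E(φ) = F`, `art = [·, E]⁻¹`) and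
**`φ · ι_K φ = u·K^×`** (Milne's (b)). [cite: Milne2007FundamentalCM, §4.2 Prop. 4.6]
[cite: Blake2016PlecticTaniyama, §1 («determined by requiring … f_Φ(g)^{1+c} = χ(g)K^×»)] -/
theorem existsUnique_finiteClassArtinMap_eq_and_mul_conj_eq (F : absoluteGaloisGroupAbelianization K)
    (u : (FiniteAdeleRing (𝓞 K) K)ˣ)
    (hF : F * absGaloisConjAb (smul_absEmbedding_eq_complexConjRat hc) F = (ideleArtinMap K ((Units.map (N := AdeleRing (𝓞 K) K)
          (MonoidHom.inr (InfiniteAdeleRing K) (FiniteAdeleRing (𝓞 K) K))) u))⁻¹) :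
    ∃! φ : (FiniteAdeleRing (𝓞 K) K)ˣ ⧸ (FiniteAdeleRing.unitEmbedding (𝓞 K) K).range,
      finiteClassArtinMap K φ = F⁻¹ ∧ φ * finiteClassConjGal K φ = QuotientGroup.mk u := by
  obtain ⟨f, hfa, hfb⟩ := exists_ideleArtinMap_inr_eq_and_inv_mul_mem_range K hc F u hF
  have hb : (QuotientGroup.mk f : (FiniteAdeleRing (𝓞 K) K)ˣ ⧸ (FiniteAdeleRing.unitEmbedding (𝓞 K) K).range) *
      finiteClassConjGal K (QuotientGroup.mk f) = QuotientGroup.mk u := by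
    rw [finiteClassConjGal_mk, ← QuotientGroup.mk_mul, QuotientGroup.eq]
    exact hfb
  refine ⟨QuotientGroup.mk f, ⟨by rw [finiteClassArtinMap_mk, hfa], hb⟩, ?_⟩
  rintro φ' ⟨ha', hb'⟩
  obtain ⟨f', rfl⟩ := QuotientGroup.mk_surjective φ'
  rw [finiteClassArtinMap_mk] at ha'
  rw [← hb, finiteClassConjGal_mk, finiteClassConjGal_mk, ← QuotientGroup.mk_mul, ← QuotientGroup.mk_mul,
    QuotientGroup.eq] at hb'
  exact QuotientGroup.eq.mpr (inv_mul_mem_range_of_ideleArtinMap_inr_eq K (ha'.trans hfa.symm) hb')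

end Prop46

/-! ### §4. `χ(σ) = χ_cyc(σ) ∈ Ẑ^× ⊂ 𝔸^×_{K,f}` -/

section Cyclotomic

variable (K : Type) [Field K] [NumberField K]

/-- **`χ(σ) ∈ Ẑ^× ⊂ 𝔸^×_{K,f}`**: the cyclotomic character of `σ ∈ Γ_ℚ` as a finite idèle OF `K` — the finite part of the
conorm `con_{K/ℚ}(1, χ_cyc σ) ∈ 𝕀_K` of row A3-G40's `cyclotomicIdele σ = (1, χ_cyc σ) ∈ 𝕀_ℚ` (Milne: «`χ_cyc : Aut(ℂ) → Ẑ^× ⊂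
𝔸^×_{f}`», read in `𝔸^×_{f,E}`). [cite: Milne2007FundamentalCM, §4 eq. (37) and §4.2 Prop. 4.6 (b)] -/
def cyclotomicFiniteIdeleIn : absoluteGaloisGroup ℚ →* (FiniteAdeleRing (𝓞 K) K)ˣ :=
  (IdeleAction.finitePart K).comp ((Units.map (NumberField.AdeleRing.baseChange ℚ K :
    AdeleRing (𝓞 ℚ) ℚ →* AdeleRing (𝓞 K) K)).comp cyclotomicIdele)

/-- Unfolding: `χ(σ) = (con_{K/ℚ}(1, χ_cyc σ))_𝐡`. [cite: Milne2007FundamentalCM, §4.2 Prop. 4.6 (b)] -/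
theorem cyclotomicFiniteIdeleIn_apply (σ : absoluteGaloisGroup ℚ) :
    cyclotomicFiniteIdeleIn K σ = IdeleAction.finitePart K (Units.map (NumberField.AdeleRing.baseChange ℚ K :
      AdeleRing (𝓞 ℚ) ℚ →* AdeleRing (𝓞 K) K) (cyclotomicIdele σ)) := rfl

/-- Unfolding on finite adèles. [cite: Milne2007FundamentalCM, §4.2 Prop. 4.6 (b)] -/
theorem coe_cyclotomicFiniteIdeleIn (σ : absoluteGaloisGroup ℚ) :
    (cyclotomicFiniteIdeleIn K σ : FiniteAdeleRing (𝓞 K) K) =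
      (NumberField.AdeleRing.baseChange ℚ K ((cyclotomicIdele σ : ideleGroup ℚ) : AdeleRing (𝓞 ℚ) ℚ)).2 := rfl

/-- **`[(1, χ(σ)), K] = [con_{K/ℚ}(1, χ_cyc σ), K]`** (`K` totally complex: the Artin symbol only sees the finite part).
[cite: Milne2007FundamentalCM, §4 eq. (37) («Ver_{E/ℚ} = art_E ∘ χ_cyc»)] -/
theorem ideleArtinMap_inr_cyclotomicFiniteIdeleIn [IsTotallyComplex K] (σ : absoluteGaloisGroup ℚ) :
    ideleArtinMap K ((Units.map (N := AdeleRing (𝓞 K) K)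
          (MonoidHom.inr (InfiniteAdeleRing K) (FiniteAdeleRing (𝓞 K) K))) (cyclotomicFiniteIdeleIn K σ)) =
      ideleArtinMap K (Units.map (NumberField.AdeleRing.baseChange ℚ K : AdeleRing (𝓞 ℚ) ℚ →* AdeleRing (𝓞 K) K)
        (cyclotomicIdele σ)) := by
  rw [cyclotomicFiniteIdeleIn_apply]
  exact FiniteIdeleClosure.ideleArtinMap_units_map_inr_finitePart K _

/-- **`Aut(K/F)` fixes `𝕀_ℚ ⊆ 𝕀_K`**: `g • con_{K/ℚ} x = con_{K/ℚ} x` (`con_{K/ℚ} = con_{K/F} ∘ con_{F/ℚ}` and `Aut(K/F)` fixes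
`𝔸_F ⊆ 𝔸_K`, `…Automorphic/ClassFieldCharacter`). [cite: CasselsFrohlichANT1967, Ch. II §19 (19.3), Ch. VII §1.1] -/
theorem smul_units_map_baseChange_rat {F : Type} [Field F] [NumberField F] [Algebra F K] (g : K ≃ₐ[F] K)
    (x : ideleGroup ℚ) :
    g • Units.map (NumberField.AdeleRing.baseChange ℚ K : AdeleRing (𝓞 ℚ) ℚ →* AdeleRing (𝓞 K) K) x =
      Units.map (NumberField.AdeleRing.baseChange ℚ K : AdeleRing (𝓞 ℚ) ℚ →* AdeleRing (𝓞 K) K) x := by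
  apply Units.ext
  rw [Literature.NumberTheory.Automorphic.AdeleRing.coe_smul_units, Units.coe_map, MonoidHom.coe_coe,
    ← adeleRing_baseChange_baseChange ℚ F K, adeleRing_baseChange_apply_eq F K,
    Literature.NumberTheory.Automorphic.AdeleRing.smul_baseChange]

variable [IsCMField K]

/-- `ι_K (x_𝐡) = (ι_K • x)_𝐡` (the Galois action on `𝕀_K = K_∞^× × (𝔸_{K,f})ˣ` is componentwise).
[cite: CasselsFrohlichANT1967, Ch. VII §1.1] -/
theorem finiteIdeleConjGal_finitePart (x : ideleGroup K) :
    finiteIdeleConjGal K (IdeleAction.finitePart K x) = IdeleAction.finitePart K (IsCMField.complexConj K • x) :=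
  Units.ext rfl

/-- **`ι_K χ(σ) = χ(σ)`**: `χ(σ)` comes from `𝕀_ℚ`, which `ι_K ∈ Gal(K/K⁺)` fixes.
[cite: Milne2007FundamentalCM, §4.2 Prop. 4.8 (proof: «f·ιf = χ(σ)χ(τ)E^×»)] -/
theorem finiteIdeleConjGal_cyclotomicFiniteIdeleIn (σ : absoluteGaloisGroup ℚ) :
    finiteIdeleConjGal K (cyclotomicFiniteIdeleIn K σ) = cyclotomicFiniteIdeleIn K σ := by
  rw [cyclotomicFiniteIdeleIn_apply, finiteIdeleConjGal_finitePart,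
    smul_units_map_baseChange_rat K (IsCMField.complexConj K)]

omit [IsCMField K] in
/-- **`χ(c) = -1`** for a complex conjugation `c ∈ Γ_ℚ` (row A3-G40 `cyclotomicFiniteIdele_of_isComplexConjugation`:
`χ_cyc(c) = -1 ∈ Ẑ^×`). [cite: Milne2007FundamentalCM, §4.2 Prop. 4.8 (c) (proof)] [cite: MilneCM2006, Ch. II §9, p. 76] -/
theorem cyclotomicFiniteIdeleIn_of_isComplexConjugation {φ : ℚ →+* ℝ} {c : absoluteGaloisGroup ℚ}
    (hc : IsComplexConjugation φ c) : cyclotomicFiniteIdeleIn K c = -1 := by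
  apply Units.ext
  rw [coe_cyclotomicFiniteIdeleIn, cyclotomicIdele_apply, cyclotomicFiniteIdele_of_isComplexConjugation hc]
  show FiniteAdeleRing.mapSemialgHom (𝓞 ℚ) ℚ K (𝓞 K) (((-1 : (FiniteAdeleRing (𝓞 ℚ) ℚ)ˣ) : FiniteAdeleRing (𝓞 ℚ) ℚ)) =
    ((-1 : (FiniteAdeleRing (𝓞 K) K)ˣ) : FiniteAdeleRing (𝓞 K) K)
  simp only [Units.val_neg, Units.val_one, map_neg, map_one]

omit [IsCMField K] in
/-- `-1 ∈ K^× ⊂ (𝔸_{K,f})ˣ`. [cite: Milne2007FundamentalCM, §4.2 Prop. 4.8 (c)] -/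
theorem neg_one_mem_range_unitEmbedding :
    (-1 : (FiniteAdeleRing (𝓞 K) K)ˣ) ∈ (FiniteAdeleRing.unitEmbedding (𝓞 K) K).range :=
  ⟨-1, Units.ext (by simp only [FiniteAdeleRing.unitEmbedding_apply, Units.val_neg, Units.val_one, map_neg, map_one])⟩

end Cyclotomic

/-! ### §5. The Taniyama element `f_Ψ(σ)`: Proposition 4.6 assembled, Proposition 4.8 (a), (c) -/

section Taniyama

variable (K : Type) [Field K] [NumberField K] [IsCMField K]

open Classical in
/-- **TATE'S TANIYAMA ELEMENT `f_Ψ(σ) ∈ 𝔸^×_{K,f}/K^×`** of a CM type `Ψ ⊆ Γ_ℚ ⧸ res(Γ_K)` of the CM field `K` (FILE 3's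
parametrisation; `c ∈ Γ_ℚ` the complex conjugation defining `F_Ψ = tateHalfTransfer K c Ψ`) at `σ ∈ Γ_ℚ`: THE unique class
`f` with **(a) `[(1, f), K] = F_Ψ(σ)⁻¹`** (Milne: `art_E(f_Φ(σ)) = F_Φ(σ)`, `art_E = [·, E]⁻¹`) and **(b) `f · ι_K f = χ(σ)·K^×`**
(`existsUnique_taniyama`; the `else` branch is never used when `c` is a complex conjugation and `Ψ` a CM type for it).
«The above definition of `f_Φ(σ)` is due to Tate» (Remark 4.7). [cite: Milne2007FundamentalCM, §4.2 Prop. 4.6, Rem. 4.7]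
[cite: Blake2016PlecticTaniyama, §1 («the associated Taniyama element»)] -/
def taniyamaElement (c : absoluteGaloisGroup ℚ) (Ψ : Set (absoluteGaloisGroup ℚ ⧸ (absGaloisRestrict ℚ K).range))
    (σ : absoluteGaloisGroup ℚ) : (FiniteAdeleRing (𝓞 K) K)ˣ ⧸ (FiniteAdeleRing.unitEmbedding (𝓞 K) K).range :=
  if h : ∃ f : (FiniteAdeleRing (𝓞 K) K)ˣ ⧸ (FiniteAdeleRing.unitEmbedding (𝓞 K) K).range,
      finiteClassArtinMap K f = (tateHalfTransfer K c Ψ σ)⁻¹ ∧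
        f * finiteClassConjGal K f = QuotientGroup.mk (cyclotomicFiniteIdeleIn K σ)
  then h.choose else 1

variable {K} {φ : ℚ →+* ℝ} {c : absoluteGaloisGroup ℚ} (hc : IsComplexConjugation φ c)
  {Ψ : Set (absoluteGaloisGroup ℚ ⧸ (absGaloisRestrict ℚ K).range)} (hΨ : IsCMTypeWith c Ψ)
include hc hΨ

/-- **The hypothesis of Proposition 4.6 for `F = F_Ψ(σ)`, `u = χ(σ)`**: `F_Ψ(σ) · θ_c^ab F_Ψ(σ) = [(1, χ(σ)), K]⁻¹` (FILE 3's
«`F_Φ(σ)·F_{ιΦ}(σ) = Ver_{E/ℚ}(σ) = art_E(χ(σ))`» and §4). [cite: Milne2007FundamentalCM, §4.2 Prop. 4.6 (proof), §4 eq. (37)] -/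
theorem tateHalfTransfer_mul_conj_eq_ideleArtinMap_inr_cyclotomicFiniteIdeleIn (σ : absoluteGaloisGroup ℚ) :
    tateHalfTransfer K c Ψ σ * absGaloisConjAb (smul_absEmbedding_eq_complexConjRat hc) (tateHalfTransfer K c Ψ σ) =
      (ideleArtinMap K ((Units.map (N := AdeleRing (𝓞 K) K)
            (MonoidHom.inr (InfiniteAdeleRing K) (FiniteAdeleRing (𝓞 K) K))) (cyclotomicFiniteIdeleIn K σ)))⁻¹ := by
  rw [tateHalfTransfer_mul_conj_eq_ideleArtinMap_cyclotomic hc hΨ, ideleArtinMap_inr_cyclotomicFiniteIdeleIn]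

/-- **PROPOSITION 4.6 for the CM type `Ψ` and `σ ∈ Γ_ℚ`**: there is a unique `f ∈ 𝔸^×_{K,f}/K^×` with (a) `[(1, f), K] = F_Ψ(σ)⁻¹`
and (b) `f · ι_K f = χ(σ)·K^×`. [cite: Milne2007FundamentalCM, §4.2 Prop. 4.6] [cite: Blake2016PlecticTaniyama, §1] -/
theorem existsUnique_taniyama (σ : absoluteGaloisGroup ℚ) :
    ∃! f : (FiniteAdeleRing (𝓞 K) K)ˣ ⧸ (FiniteAdeleRing.unitEmbedding (𝓞 K) K).range,
      finiteClassArtinMap K f = (tateHalfTransfer K c Ψ σ)⁻¹ ∧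
        f * finiteClassConjGal K f = QuotientGroup.mk (cyclotomicFiniteIdeleIn K σ) :=
  existsUnique_finiteClassArtinMap_eq_and_mul_conj_eq K hc _ _
    (tateHalfTransfer_mul_conj_eq_ideleArtinMap_inr_cyclotomicFiniteIdeleIn hc hΨ σ)

/-- `f_Ψ(σ)` satisfies (a) and (b). [cite: Milne2007FundamentalCM, §4.2 Prop. 4.6] -/
theorem taniyamaElement_spec (σ : absoluteGaloisGroup ℚ) :
    finiteClassArtinMap K (taniyamaElement K c Ψ σ) = (tateHalfTransfer K c Ψ σ)⁻¹ ∧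
      taniyamaElement K c Ψ σ * finiteClassConjGal K (taniyamaElement K c Ψ σ) =
        QuotientGroup.mk (cyclotomicFiniteIdeleIn K σ) := by
  have h := (existsUnique_taniyama hc hΨ σ).exists
  rw [taniyamaElement, dif_pos h]
  exact h.choose_spec

/-- **(a) `art_K(f_Ψ(σ)) = F_Ψ(σ)`**, i.e. `[(1, f_Ψ(σ)), K] = F_Ψ(σ)⁻¹`. [cite: Milne2007FundamentalCM, §4.2 Prop. 4.6 (a)] -/
theorem finiteClassArtinMap_taniyamaElement (σ : absoluteGaloisGroup ℚ) :
    finiteClassArtinMap K (taniyamaElement K c Ψ σ) = (tateHalfTransfer K c Ψ σ)⁻¹ :=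
  (taniyamaElement_spec hc hΨ σ).1

/-- **(b) `f_Ψ(σ) · ι f_Ψ(σ) = χ(σ)·K^×`** (Blake: «`f_Φ(g)^{1+c} = χ(g)K^×`»). [cite: Milne2007FundamentalCM, §4.2 Prop. 4.6 (b)]
[cite: Blake2016PlecticTaniyama, §1] -/
theorem taniyamaElement_mul_finiteClassConjGal (σ : absoluteGaloisGroup ℚ) :
    taniyamaElement K c Ψ σ * finiteClassConjGal K (taniyamaElement K c Ψ σ) =
      QuotientGroup.mk (cyclotomicFiniteIdeleIn K σ) :=
  (taniyamaElement_spec hc hΨ σ).2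

/-- **Uniqueness**: any class with (a) and (b) IS `f_Ψ(σ)` («Thus `f` satisfies the conditions that determine `f_Φ(στ)`»).
[cite: Milne2007FundamentalCM, §4.2 Prop. 4.6 (uniqueness), Prop. 4.8 (proof)] -/
theorem eq_taniyamaElement {σ : absoluteGaloisGroup ℚ}
    {f : (FiniteAdeleRing (𝓞 K) K)ˣ ⧸ (FiniteAdeleRing.unitEmbedding (𝓞 K) K).range}
    (ha : finiteClassArtinMap K f = (tateHalfTransfer K c Ψ σ)⁻¹)
    (hb : f * finiteClassConjGal K f = QuotientGroup.mk (cyclotomicFiniteIdeleIn K σ)) :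
    f = taniyamaElement K c Ψ σ :=
  (existsUnique_taniyama hc hΨ σ).unique ⟨ha, hb⟩ (taniyamaElement_spec hc hΨ σ)

/-- **Representatives**: a finite idèle `f` represents `f_Ψ(σ)` iff `[(1, f), K] = F_Ψ(σ)⁻¹` and `(f·ι_K f)⁻¹ χ(σ) ∈ K^×`.
[cite: Milne2007FundamentalCM, §4.2 Prop. 4.6] -/
theorem mk_eq_taniyamaElement_iff {σ : absoluteGaloisGroup ℚ} (f : (FiniteAdeleRing (𝓞 K) K)ˣ) :
    (QuotientGroup.mk f : (FiniteAdeleRing (𝓞 K) K)ˣ ⧸ (FiniteAdeleRing.unitEmbedding (𝓞 K) K).range) =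
        taniyamaElement K c Ψ σ ↔
      ideleArtinMap K ((Units.map (N := AdeleRing (𝓞 K) K)
            (MonoidHom.inr (InfiniteAdeleRing K) (FiniteAdeleRing (𝓞 K) K))) f) = (tateHalfTransfer K c Ψ σ)⁻¹ ∧
        (f * finiteIdeleConjGal K f)⁻¹ * cyclotomicFiniteIdeleIn K σ ∈ (FiniteAdeleRing.unitEmbedding (𝓞 K) K).range := by
  rw [← finiteClassArtinMap_mk, ← QuotientGroup.eq, QuotientGroup.mk_mul, ← finiteClassConjGal_mk]
  exact ⟨fun h => by rw [h]; exact taniyamaElement_spec hc hΨ σ, fun h => eq_taniyamaElement hc hΨ h.1 h.2⟩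

omit [IsCMField K] hc in
/-- A translate of a CM type is a CM type (private copy of `IsCMTypeWith.smul_set` of `…/ReflexDegreeQuadraticSubfieldBound`,
imports kept light). [cite: Milne2007FundamentalCM, §4.2 Lemma 4.4 (proof)] -/
private theorem isCMTypeWith_smul_set (τ : absoluteGaloisGroup ℚ) : IsCMTypeWith c (τ • Ψ) where
  mem_iff x := by
    rw [Set.mem_smul_set_iff_inv_smul_mem, Set.mem_smul_set_iff_inv_smul_mem, hΨ.mem_iff, hΨ.comm]
  comm := hΨ.comm
  invol := hΨ.invol

/-- **PROPOSITION 4.8 (a): `f_Ψ(στ) = f_{τΨ}(σ) · f_Ψ(τ)`.**  PROOF as printed: `f = f_{τΨ}(σ)·f_Ψ(τ)` has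
`[(1,f), K] = F_{τΨ}(σ)⁻¹ F_Ψ(τ)⁻¹ = F_Ψ(στ)⁻¹` (FILE 3 `tateHalfTransfer_mul`) and `f·ιf = χ(σ)χ(τ)K^× = χ(στ)K^×`, so `f`
satisfies the conditions that determine `f_Ψ(στ)`. [cite: Milne2007FundamentalCM, §4.2 Prop. 4.8 (a)] -/
theorem taniyamaElement_mul (σ τ : absoluteGaloisGroup ℚ) :
    taniyamaElement K c Ψ (σ * τ) = taniyamaElement K c (τ • Ψ) σ * taniyamaElement K c Ψ τ := by
  have hτΨ : IsCMTypeWith c (τ • Ψ) := isCMTypeWith_smul_set hΨ τ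
  symm
  refine eq_taniyamaElement hc hΨ ?_ ?_
  · rw [map_mul (finiteClassArtinMap K), finiteClassArtinMap_taniyamaElement hc hτΨ,
      finiteClassArtinMap_taniyamaElement hc hΨ, tateHalfTransfer_mul hc hΨ, mul_inv]
  · rw [map_mul (cyclotomicFiniteIdeleIn K), QuotientGroup.mk_mul, ← taniyamaElement_mul_finiteClassConjGal hc hτΨ σ,
      ← taniyamaElement_mul_finiteClassConjGal hc hΨ τ, map_mul (finiteClassConjGal K)]
    exact mul_mul_mul_comm (taniyamaElement K c (τ • Ψ) σ) _ _ _

/-- `f_Ψ(στ) = f_Ψ(σ)·f_Ψ(τ)` when `τΨ = Ψ`: **`f_Ψ` is a homomorphism on the stabiliser of `Ψ`** (= `Γ_{K*}`, `K*` the reflex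
field). [cite: Milne2007FundamentalCM, §4.2 Prop. 4.8 (a), Prop. 4.9] -/
theorem taniyamaElement_mul_of_smul_eq (σ : absoluteGaloisGroup ℚ) {τ : absoluteGaloisGroup ℚ} (hτ : τ • Ψ = Ψ) :
    taniyamaElement K c Ψ (σ * τ) = taniyamaElement K c Ψ σ * taniyamaElement K c Ψ τ := by
  rw [taniyamaElement_mul hc hΨ, hτ]

/-- **PROPOSITION 4.8 (c): `f_Ψ(c) = 1`** (`F_Ψ(c) = 1` and `χ(c) = -1 ∈ K^×`). [cite: Milne2007FundamentalCM, §4.2 Prop. 4.8 (c)] -/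
theorem taniyamaElement_self : taniyamaElement K c Ψ c = 1 := by
  symm
  refine eq_taniyamaElement hc hΨ ?_ ?_
  · rw [map_one (finiteClassArtinMap K), tateHalfTransfer_self hc hΨ, inv_one]
  · rw [map_one (finiteClassConjGal K), mul_one, cyclotomicFiniteIdeleIn_of_isComplexConjugation K hc]
    exact ((QuotientGroup.eq_one_iff _).mpr (neg_one_mem_range_unitEmbedding K)).symm

/-- `f_Ψ(1) = 1`. [cite: Milne2007FundamentalCM, §4.2 Prop. 4.8 (a)] -/
theorem taniyamaElement_one : taniyamaElement K c Ψ 1 = 1 := by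
  symm
  refine eq_taniyamaElement hc hΨ ?_ ?_
  · rw [map_one (finiteClassArtinMap K), tateHalfTransfer_one hc hΨ, inv_one]
  · rw [map_one (finiteClassConjGal K), mul_one, map_one (cyclotomicFiniteIdeleIn K), QuotientGroup.mk_one]

end Taniyama

end Literature.NumberTheory.ComplexMultiplication

end
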